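import Summits.CriticalPhenomena.PercolationContinuityZ3.Theorems.PercNearOneGluingNoHeavyLowerTailSahiThreeCopySlices

/-!
# `NoHeavyLowerTail` (crux stmt-CriticalPhenomena-4575), Sahi programme: **THE SLICE LAW** — the alternating identity
# `c_{(1,b)} − c_{(2,b)} + c_{(3,b)} − c_{(0,b)} = N_b(δF;δG;δH)`, the conjectured cross-slice inequality `c_{(2,b)} ≥ 2c_{(3,b)}` (SC),
# and the reduction **(SC) ⇒ 3C-SAHI**

Support file (Sahi cell, seat `prim-sahi-p1`, generation 56; `--supports stmt-CriticalPhenomena-4575`); companion of `…SahiThreeCopySlices`.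
Pure proofs and one `@[conjecture] def`; no `sorry`, standard axioms; nothing conjectural is used as a hypothesis-free fact.

THE OBJECTS.  For a triple `(F,G,H)` on `{0,1}^{d+1}` with sections `F⁰ ≤ F¹` etc. along coordinate `0` and a profile `b` of the other
coordinates write `c_k := c_{(k,b)}(F,G,H)` (`k = 0,…,3`, `tc (Fin.cons k b) F G H`), so `c₀ = c_b(F⁰,G⁰,H⁰)` and `c₃ = c_b(F¹,G¹,H¹)`
(`tc_cons_zero/three`), and `δF = F¹ − F⁰ ≥ 0`.
* `tc_cons_alt` (★ identity, all real data): **`c₁ − c₂ + c₃ − c₀ = N_b(δF;δG;δH)`** — the coefficient of `p³` when the coordinate-`0`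
  probability `p` is separated; in particular `c₁ + c₃ ≥ c₀ + c₂` for nested sections (`tc_cons_alt_nonneg`).
* `SliceLaw` (`@[conjecture] def`, OPEN): **(SC) `2·c_b(F¹,G¹,H¹) ≤ c_{(2,b)}(F,G,H)`** for all nonnegative monotone triples, all `d`, all `b`.
  EVIDENCE (this generation, kit j335073 / j335141): the cone spanned by the slice vectors `(c₀,c₁,c₂,c₃)` of all up-set triples has EXACTLY
  the facets `c₀ ≥ 0, c₃ ≥ 0, c₂ ≥ 2c₃, c₁ + c₃ ≥ c₀ + c₂` — exhaustively on `{0,1}^n` for `n ≤ 4` (8.5·10⁵ triples × 4 axes × 64 profiles at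
  n = 4) and on 3.6·10⁵ random triples at n = 5, 6; the sharper-looking small-n laws `c₁ ≥ (3/2)c₀ + c₃`, `c₂ ≥ (1/2)c₀ + 2c₃` hold for
  `n ≤ 3` and FAIL from `n = 4` (minimum −1).  (SC) is a facet, attained e.g. by every AND-literal first slot.
* ★★ `threeCopySahi_of_sliceLaw`: **(SC) ⇒ 3C-SAHI** (`ThreeCopySahi` of `…SahiThreeCopy`, hence Sahi's `C₃` for every product measure
  and Kahn's conjectured inequality, by `…SahiThreeCopyBernstein`).  Proof: induction on the dimension; `c₀, c₃ ≥ 0` by induction,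
  `c₂ ≥ 2c₃ ≥ 0` by (SC), `c₁ = c₀ + c₂ − c₃ + N(δF;δG;δH) ≥ c₀ + c₃ + 0 ≥ 0` by the identity; conversely (SC) at lifted data is 3C one
  dimension down, so (SC) is a single self-contained sharpening of the inductive step.  Why it matters (memo FROM-prim-sahi-p1-gen56 §2bis):
  every LINEAR inductive certificate for the one-coordinate step is impossible (the equality locus does not factor through sections), and
  (SC) is exactly the part of the step that survives as a sharp universal inequality; its excess over `2c₃` has the closed form
  `c_b(F⁰,G⁰,H⁰) + Y(F⁰;δG,δH) + Y(G⁰;δF,δH) + Y(H⁰;δF,δG) + Y(δF;δG,δH) + [N(δF;δGδH;1) − N(δF;δG;δH)]`, `Y(u;v,w) = N(v;uw;1) +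
  N(w;uv;1) − N(u;v;w)` (`tc_cons_two_sub`).  [this work]
-/

namespace Summit.CriticalPhenomena.PercolationContinuityZ3.Theorems.SahiThreeCopy

open Finset Function Literature.Combinatorics.Sahi2008
open scoped BigOperators

noncomputable section

variable {d : ℕ}

/-! ### §1 The alternating identity -/

/-- ★ **`c₁ − c₂ + c₃ − c₀ = N_b(δF;δG;δH)`**: the alternating sum of the four slices of the three-copy Sahi coefficient along a coordinate
is the three-copy functional of the three increments (all data real). [this work] -/
theorem tc_cons_alt (b : Fin d → ℕ) (F G H : Pt (d + 1) → ℝ) :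
    tc (Fin.cons 1 b : Fin (d + 1) → ℕ) F G H - tc (Fin.cons 2 b : Fin (d + 1) → ℕ) F G H
      + tc (Fin.cons 3 b : Fin (d + 1) → ℕ) F G H - tc (Fin.cons 0 b : Fin (d + 1) → ℕ) F G H =
      N3 b (sec F true - sec F false) (sec G true - sec G false) (sec H true - sec H false) := by
  rw [tc_cons_zero, tc_cons_one, tc_cons_two, tc_cons_three]
  unfold tc
  simp only [mul_sub, sub_mul, N3_sub_left, N3_sub_mid, N3_sub_right]
  ring

/-- Hence `c₁ + c₃ ≥ c₀ + c₂` for nested nonnegative sections (e.g. monotone nonnegative `F, G, H`). [this work] -/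
theorem tc_cons_alt_nonneg (b : Fin d → ℕ) {F G H : Pt (d + 1) → ℝ} (hFm : Monotone F) (hGm : Monotone G) (hHm : Monotone H) :
    tc (Fin.cons 0 b : Fin (d + 1) → ℕ) F G H + tc (Fin.cons 2 b : Fin (d + 1) → ℕ) F G H ≤
      tc (Fin.cons 1 b : Fin (d + 1) → ℕ) F G H + tc (Fin.cons 3 b : Fin (d + 1) → ℕ) F G H := by
  have h := tc_cons_alt b F G H
  have hN : 0 ≤ N3 b (sec F true - sec F false) (sec G true - sec G false) (sec H true - sec H false) :=
    N3_nonneg b (fun x => sub_nonneg.2 (sec_false_le_sec_true hFm x)) (fun x => sub_nonneg.2 (sec_false_le_sec_true hGm x))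
      fun x => sub_nonneg.2 (sec_false_le_sec_true hHm x)
  linarith

/-! ### §2 The slice law (SC) — an OBLIGATION, never a fact -/

/-- **(SC) THE SLICE LAW** (conjecture of this generation; OPEN): for every dimension `d`, profile `b`, and nonnegative monotone
`F, G, H : {0,1}^{d+1} → ℝ`, the slice `c_{(2,b)}(F,G,H)` is at least twice the top slice `c_{(3,b)} = c_b(F¹,G¹,H¹)`.
Evidence: exhaustive for up-set triples on `{0,1}^n`, `n ≤ 4`, and 3.6·10⁵ random triples at `n = 5, 6` (kit j335073, j335141); it is a
FACET of the cone of slice vectors.  `threeCopySahi_of_sliceLaw`: (SC) ⇒ 3C-SAHI.  OPEN — an obligation / hypothesis, never a fact; a proof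
would be `SliceLaw_holds`. [this work] [status: open] -/
@[conjecture] def SliceLaw : Prop :=
  ∀ (d : ℕ) (b : Fin d → ℕ) (F G H : Pt (d + 1) → ℝ), (∀ x, 0 ≤ F x) → (∀ x, 0 ≤ G x) → (∀ x, 0 ≤ H x) →
    Monotone F → Monotone G → Monotone H →
      2 * tc b (sec F true) (sec G true) (sec H true) ≤ tc (Fin.cons 2 b : Fin (d + 1) → ℕ) F G H

/-- In dimension `0` the three-copy Sahi coefficient vanishes: `c_b(f,g,h) = 2fgh − 3fgh + fgh = 0` on a point. [this work] -/
theorem tc_dim_zero (b : Fin 0 → ℕ) (f g h : Pt 0 → ℝ) : tc b f g h = 0 := by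
  unfold tc
  simp only [N3_dim_zero, Pi.mul_apply, Pi.one_apply]
  ring

/-- ★★ **(SC) ⇒ 3C-SAHI.**  If the slice law holds in every dimension then `0 ≤ c_b(f,g,h)` for all nonnegative monotone `f, g, h` on
every cube and every profile: induction on the dimension, the slices `k = 0, 3` being the section triples, `k = 2` by (SC), and `k = 1`
by the alternating identity `c₁ = c₀ + c₂ − c₃ + N(δF;δG;δH) ≥ c₀ + c₃ ≥ 0`. [this work] -/
theorem threeCopySahi_of_sliceLaw (hSC : SliceLaw) : ThreeCopySahi := by
  intro d
  induction d with
  | zero =>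
    intro b f g h _ _ _ _ _ _
    rw [tc_dim_zero]
  | succ d ih =>
    intro b F G H hF hG hH hFm hGm hHm
    have hb : b = Fin.cons (b 0) (Fin.tail b) := (Fin.cons_self_tail b).symm
    set b' := Fin.tail b
    have h0 : 0 ≤ tc (Fin.cons 0 b' : Fin (d + 1) → ℕ) F G H := by
      rw [tc_cons_zero]
      exact ih b' _ _ _ (sec_nonneg hF false) (sec_nonneg hG false) (sec_nonneg hH false) (sec_monotone hFm false)
        (sec_monotone hGm false) (sec_monotone hHm false)
    have h3 : 0 ≤ tc (Fin.cons 3 b' : Fin (d + 1) → ℕ) F G H := by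
      rw [tc_cons_three]
      exact ih b' _ _ _ (sec_nonneg hF true) (sec_nonneg hG true) (sec_nonneg hH true) (sec_monotone hFm true)
        (sec_monotone hGm true) (sec_monotone hHm true)
    have h3' : tc (Fin.cons 3 b' : Fin (d + 1) → ℕ) F G H = tc b' (sec F true) (sec G true) (sec H true) := tc_cons_three b' F G H
    have h2 : 2 * tc b' (sec F true) (sec G true) (sec H true) ≤ tc (Fin.cons 2 b' : Fin (d + 1) → ℕ) F G H :=
      hSC d b' F G H hF hG hH hFm hGm hHm
    have halt := tc_cons_alt_nonneg b' hFm hGm hHm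
    rw [hb]
    match hk : b 0 with
    | 0 => exact h0
    | 1 => linarith
    | 2 => linarith
    | 3 => exact h3
    | k + 4 => rw [tc_cons_add_four]

/-- Conversely the slice law at data lifted along coordinate `0` is 3C-SAHI one dimension down: for `F = f ∘ tail` etc.
`c_{(2,b)} = 3c_b(f,g,h)` and `c_b(F¹,G¹,H¹) = c_b(f,g,h)`, so (SC) reads `2c ≤ 3c`. [this work] -/
theorem tc_cons_two_lift (b : Fin d → ℕ) (f g h : Pt d → ℝ) :
    tc (Fin.cons 2 b : Fin (d + 1) → ℕ) (fun x => f (Fin.tail x)) (fun x => g (Fin.tail x)) (fun x => h (Fin.tail x)) = 3 * tc b f g h := by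
  have hs : ∀ (u : Pt d → ℝ) (ε : Bool), sec (fun x : Pt (d + 1) => u (Fin.tail x)) ε = u := by
    intro u ε; funext x; simp [sec, Fin.tail_cons]
  have hz : ∀ u : Pt d → ℝ, N3 b u 0 1 = 0 := fun u => by rw [N3_comm12, N3_zero_left]
  rw [tc_cons_two]
  simp only [hs, sub_self, zero_mul, mul_zero, N3_zero_left, hz, sub_zero, add_zero]
  ring

/-! ### §3 The excess of (SC) in closed form -/

/-- ★ **The (SC)-excess**: with `δX = X¹ − X⁰` and `Y(u;v,w) = N(v;uw;1) + N(w;uv;1) − N(u;v;w)` (slots written in the order F, G, H,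
using the symmetry of `N_b`),
`c_{(2,b)} − 2c_b(F¹,G¹,H¹) = c_b(F⁰,G⁰,H⁰) + Y(F⁰;δG,δH) + Y(G⁰;δF,δH) + Y(H⁰;δF,δG) + Y(δF;δG,δH) + [N(δF;δGδH;1) − N(δF;δG;δH)]`
(all data real).  Each `Y` is `≥ 0` when one of its two difference arguments is monotone (three-copy Harris with the other as a spectator);
the conjecture (SC) says the four `Y`-defects never exceed `c_b(F⁰,G⁰,H⁰)` plus the last bracket. [this work] -/
theorem tc_cons_two_sub (b : Fin d → ℕ) (F G H : Pt (d + 1) → ℝ) :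
    tc (Fin.cons 2 b : Fin (d + 1) → ℕ) F G H - 2 * tc b (sec F true) (sec G true) (sec H true) =
      tc b (sec F false) (sec G false) (sec H false)
      + (N3 b (sec G true - sec G false) (sec F false * (sec H true - sec H false)) 1
          + N3 b (sec H true - sec H false) (sec F false * (sec G true - sec G false)) 1
          - N3 b (sec F false) (sec G true - sec G false) (sec H true - sec H false))
      + (N3 b (sec F true - sec F false) (sec G false * (sec H true - sec H false)) 1
          + N3 b (sec H true - sec H false) ((sec F true - sec F false) * sec G false) 1
          - N3 b (sec F true - sec F false) (sec G false) (sec H true - sec H false))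
      + (N3 b (sec F true - sec F false) ((sec G true - sec G false) * sec H false) 1
          + N3 b (sec G true - sec G false) ((sec F true - sec F false) * sec H false) 1
          - N3 b (sec F true - sec F false) (sec G true - sec G false) (sec H false))
      + (N3 b (sec G true - sec G false) ((sec F true - sec F false) * (sec H true - sec H false)) 1
          + N3 b (sec H true - sec H false) ((sec F true - sec F false) * (sec G true - sec G false)) 1
          - N3 b (sec F true - sec F false) (sec G true - sec G false) (sec H true - sec H false))
      + (N3 b (sec F true - sec F false) ((sec G true - sec G false) * (sec H true - sec H false)) 1
          - N3 b (sec F true - sec F false) (sec G true - sec G false) (sec H true - sec H false)) := by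
  rw [tc_cons_two]
  unfold tc
  simp only [mul_sub, sub_mul, N3_sub_left, N3_sub_mid, N3_sub_right]
  ring

end

end Summit.CriticalPhenomena.PercolationContinuityZ3.Theorems.SahiThreeCopy
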